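import Summits.AtomisticToContinuum.Crystallization.Theses.GscTwinLoopSurgery

/-!
# Route `GscTwinLoopSurgery` — item `Assembly` (stmt-AtomisticToContinuum-14088)

The assembly item of route `GscTwinLoopSurgery` (sub-problem `Crystallization` of the summit
`AtomisticToContinuum`) is the implication

  `LocalLimitStable → LayeredWindows → TwinLoopLemma → HcpPerfectWindows →
   LjRegistryDomination → NoFoam → GscHingeGlue → ChargedPeriodicIsOptimal →
   ChargedPatternCrystallizes → CrysEnergyLimit → Crystallization`,

i.e. the ten binders of the route's deciding theorem
`Summit.AtomisticToContinuum.Crystallization.Theses.GscTwinLoopSurgery.closes`, in the same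
order, imply the sub-problem statement `_root_.Crystallization`.  `closes` is sorry-free in the
Theses file (axioms `propext`, `Classical.choice`, `Quot.sound`), so the item is settled by
unfolding `Assembly` and invoking `closes`.

Logic of `closes`, for the record: `hGlue hStable hWindows hLoop hHcp hDom hFoam` is the shared
finite-`N` hinge `GroundStatesChargePeriodic`; conjunct (ii) of `Crystallization`
(`IsCrystallizing lennardJones 3`) is `ChargedPatternCrystallizes` applied to the hinge and the
proved fact `LennardJonesMinimalDistance_holds`; for conjunct (i)
(`HasPeriodicGroundStateEnergy lennardJones 3`) the proved fact
`LennardJonesGroundStatesExist_holds` supplies a ground-state sequence, the hinge charges some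
periodic `Q`, `ChargedPeriodicIsOptimal` makes `e(Q)` the least periodic energy per particle, and
`IsLeast.csInf_eq` rewrites `CrysEnergyLimit` (`E(N)/N → ⨅_Q' e(Q')`) as `E(N)/N → e(Q)`.

Nothing else is proved here; the ten hypotheses remain the route's items.
-/

namespace Summit.AtomisticToContinuum.Crystallization.Theorems

open Summit.AtomisticToContinuum.Crystallization.Theses.GscTwinLoopSurgery

/-- **Item `Assembly`** (stmt-AtomisticToContinuum-14088, route `GscTwinLoopSurgery`): the ten
binders `LocalLimitStable`, `LayeredWindows`, `TwinLoopLemma`, `HcpPerfectWindows`,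
`LjRegistryDomination`, `NoFoam`, `GscHingeGlue`, `ChargedPeriodicIsOptimal`,
`ChargedPatternCrystallizes`, `CrysEnergyLimit` imply `Crystallization` — literally the route's
deciding theorem `Theses.GscTwinLoopSurgery.closes`. [folklore] -/
theorem gscTwinLoopSurgery_assembly_proof :
    Summit.AtomisticToContinuum.Crystallization.Theses.GscTwinLoopSurgery.Assembly := by
  unfold Summit.AtomisticToContinuum.Crystallization.Theses.GscTwinLoopSurgery.Assembly
  exact closes

end Summit.AtomisticToContinuum.Crystallization.Theorems
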